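import Summits.QuantumFields.YangMills.Theorems.BalabanUVNodesK2CornerRoadRowMassRunsKeyed
import Summits.QuantumFields.YangMills.Theorems.BalabanUVNodesK1V10Defs

/-!
# Route `BalabanUVNodes` rev 29 — THE CORNER ROAD AND THE ROW-MASS ROAD ON K1 «v10» LINE 2′ (window-guarded rungs; hypothesis form; 0 `def`, 0 `sorry`):
# the REGISTERED `stub_runRows13PWSVW` ∕ `stub_cont13VW` signatures BY NAME under {N11CU at the slot world (in-window), U3ᴷ-lite, anchor + positive drift} resp. {…, (α♭) one lower-(0.31) run per depth}

Cell `ym-nodeO-ideate`, PROVER seat `ym-nodeO-port-1` (gen 5).  Sibling of `…K2CornerRoadLine2` (p630391: LINE 2, V rungs) and `…K2CornerRoadRowMassRuns(Keyed)` (p632863 ∕ the keyed sibling: the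
row-mass road); imports DEF-1's by-name mirror of the v10 LINE-2′ texts `…K1V10Defs` (`NodesAtSomeRecord13PWSVW`, `RunRowsAtSomeRecord13PWSVW`, `RunRowsContAtSomeRecord13PWSVW`, the
doors `…VW_of_V`, the projection `runRowsAtSomeRecord13PWSVW_of_runRowsContAtSomeRecord13PWSVW`; p634834).  Helper keyed `--supports stmt-QuantumFields-27364 --as helper` (K1⁹ `StabilityBRunRowsAtRecordR13SepCoPHV`, DECIDING); count-neutral; NO skeleton registered or re-keyed.

WHY.  Plan g86 registered «v10» = LINE 1 ∪ LINE 2′ on the K1⁹ item (sha256 4b84746c2d4b6041…, 2026-08-28T12:43:28Z; HARD FREEZE after it): LINE 2′ = LINE 2 with the thirteen nodes and the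
[IV]-pin asked only on runs INSIDE THE WORLD's COUPLING WINDOW, `(leavesP w P).smallCouplings → Nodes (leavesP w P)` (dag-n24-c g11 LOCATED-RUNG1-PIN option (α); [IV] (1.2) p. 178 as printed);
the rows block is BYTE-IDENTICAL V → VW.  Every V-rung result feeds the VW rungs through DEF-1's one-line doors, so p630391 ∕ p632863's K1⁹-by-name concluders stand; but a proof of the
REGISTERED stub 1ⱽᵂ hands only WINDOW-GUARDED nodes, which the V producers do not accept — this file re-types the two β-side roads at a rung-1ⱽᵂ witness.  The only non-trivial point is the
N11CU raise under the guard (§1): the coupling window `(leavesP w P).smallCouplings = (w.C P).flow.InInterval w.γ P.K` SHRINKS with the re-lettered window `γ' ≤ w.γ`, so the guarded nodes at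
`w` still serve the re-lettered world; N11 is then asked only in-window at the raised ceiling (a letter INCOMPARABLE with p630391's `hN11V`: antecedent cut to
GUARDED node data, conclusion relaxed to IN-WINDOW `Dag.B14_main` at some `γ' ≤ w.γ` — the LINE 2′ relaxation; no theorem here compares the two letters).

CONTENTS.  §1 `smallCouplings_of_reletter_le` · `ceilingKeyedRung1VW_of_nodesW_of_b14RaiseW` (ONE rung-1ⱽᵂ core datum + N11 in-window at every raised ceiling ⟹ the guarded ceiling-keyed
family `∀ c, ∃ w', c ≤ w'.βup ∧ RecordSV F θ h v w' ∧ ∀ P, (leavesP w' P).smallCouplings → Nodes (leavesP w' P)`).  §2 CORNER ROAD: `runRowsContAtSomeRecord13PWSVW_of_rung1VWAt_cornerLetters_lt` ·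
`…_of_ceilingKeyedRung1VW_cornerLetters` · ★ `stub_runRowsCont13VWText_of_n11CUVW_liteText_cornerText` · `stub_runRows13PWSVWText_of_…` (= the REGISTERED `stub_runRows13PWSVW` signature).  §3
ROW-MASS ROAD: `runRowsContAtSomeRecord13PWSVW_of_rung1VWAt_rowMassRuns_le` · `…_of_ceilingKeyedRung1VW_rowMassRuns` · ★ `stub_runRowsCont13VWText_of_n11CUVW_rowMassRunsText` ·
`stub_runRows13PWSVWText_of_…`.  §4 (C): ★ `stub_cont13VWText_of_boxModuli` (= the REGISTERED `stub_cont13VW` signature from moduli on SOME box — both roads' U3ᴷ-lite letters qualify).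
K1⁹ BY NAME from the VW rungs needs the window-guarded END road (plan v10 §R9W `stabilityB_body_of_rung1VWAt_of_runLetters`, dag-n13-w3's lane) and is NOT restated here; from the V rungs it is
p630391 §3 ∕ p632863 §4 ∕ the keyed sibling §4.

HONEST FRAMING.  Bookkeeping over displayed HYPOTHESIS SHAPES + p622247's ∕ p632863's elementary real analysis + DEF-1 ∕ N11CU doors BY NAME; NOTHING of Bałaban's analysis is asserted or
discharged; inhabitation of U3ᴷ-lite ∕ the anchor ∕ the positive drift ∕ (α♭) ∕ N11CUᵂ at the record NOT claimed (instance 0∕1); no stub proved or closed; K0⁷ ∕ K1⁹ (v10 0∕6) ∕ K3⁸ OPEN;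
counts unmoved (typed 28∕28 · discharged 5∕27 (A 5∕28)); [Balaban1987RG1] Thm 2 + (0.31) p. 259 and §1's continuity pp. 263–264 UNPROVED IN PRINT; route R4 closes the CONDITIONAL finite-𝕋⁴
rung `BalabanLadder.UV` only — NOT the continuum limit, NOT ℝ⁴, NOT OS, NOT the Yang–Mills mass gap, NOT Clay.  No `def`, no `instance`, no `notation`, no `axiom`.
Sources (context only): [I] = [Balaban1987RG1] CMP **109** (1987): (0.20) p. 256, Thm 2 + (0.31) p. 259, §1 pp. 263–264, Thm 3 p. 264, (2.12)–(2.14) p. 268, (5.10) p. 293, §5 p. 298;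
[III] = [Balaban1988Convergent] CMP **119** (1988): Thm 1 p. 262, (2.6) p. 255; [IV] = [Balaban1989LargeFieldI] CMP **122** (1989): (1.2) p. 178; [V] = [Balaban1989LargeFieldII]: Thm 1 p. 355.
-/

noncomputable section

open scoped Matrix.Norms.L2Operator

namespace Summit.QuantumFields.YangMills.Theorems.BalabanUVNodesK2CornerRoadLine2W

open Finset
open Literature.MathematicalPhysics.QuantumFieldTheory.Balaban1983to89
open Literature.MathematicalPhysics.QuantumFieldTheory.Balaban1983to89.T4Continuum
open Literature.MathematicalPhysics.QuantumFieldTheory.Balaban1983to89.DagBinding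
open Literature.MathematicalPhysics.QuantumFieldTheory.Balaban1983to89.FlowStep (HBeta prefixOf RGEqH)
open Literature.MathematicalPhysics.QuantumFieldTheory.Balaban1983to89.T4CouplingMatching (HistLipschitz)
open Literature.MathematicalPhysics.QuantumFieldTheory.Balaban1983to89.Beta.Drift (OneLoopDrift)
open Summit.QuantumFields.YangMills.Theorems.BalabanUVNodesK2NamedJetsRemAt (ScaleAnchor)
open Summit.QuantumFields.YangMills.Theorems.BalabanUVNodesK2NamedJetsRunRemAt (RunConstRemainder SurvCont)
open Summit.QuantumFields.YangMills.Theorems.K1V9Defs (RecordSV)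
open Summit.QuantumFields.YangMills.Theorems.K1V10Defs (NodesAtSomeRecord13PWSVW RunRowsAtSomeRecord13PWSVW RunRowsContAtSomeRecord13PWSVW runRowsAtSomeRecord13PWSVW_of_runRowsContAtSomeRecord13PWSVW)
open Summit.QuantumFields.YangMills.Theorems.BalabanUVNodesK1RunRowsTextOfN11CUOfRowsWF (nodes_leavesP_reletter_ceiling)
open Summit.QuantumFields.YangMills.Theorems.BalabanUVNodesK2CornerRoadLine2 (runLettersAtCeiling_at recordSV_reletter_ceiling)
open Summit.QuantumFields.YangMills.Theorems.BalabanUVNodesK2CornerRoadRowMassRunsKeyed (runLettersAtCeiling_of_rowMass_runs)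

variable {F : T4Family}

/-! ## §1 The N11CU raise UNDER THE WINDOW GUARD -/

section Reletter

/-- The coupling window SHRINKS with the re-lettered window: for `γ' ≤ w.γ`, a run inside `{w with βup := c, γ := γ'}`'s window (`(w.C P).flow.InInterval γ' P.K`) is inside `w`'s.
[cite: Balaban1989LargeFieldI, (1.2) p.178 (bookkeeping)] -/
theorem smallCouplings_of_reletter_le (w : WorldP) {c γ' : ℝ} (hγ' : γ' ≤ w.γ) (P : B12.RunParams)
    (h : (leavesP { w with βup := c, γ := γ' } P).smallCouplings) : (leavesP w P).smallCouplings :=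
  fun k hk => ⟨(h k hk).1, (h k hk).2.trans hγ'⟩

/-- **THE GUARDED CEILING-KEYED RUNG-1ⱽᵂ FAMILY FROM ONE SLOT WITNESS AND THE IN-WINDOW N11 RAISE** (the LINE-2′ twin of p630391's `ceilingKeyedRung1V_of_nodes_of_b14Raise`): at ONE rung-1ⱽᵂ core
datum `(θ, h, v, w)` (`RecordSV`, the thirteen nodes at every run INSIDE the coupling window), if N11 = `Dag.B14_main` holds IN-WINDOW at EVERY ceiling letter `c` after re-lettering the window to
SOME `γ' ∈ ]0, w.γ]`, then `∀ c, ∃ w', c ≤ w'.βup ∧ RecordSV F θ h v w' ∧ ∀ P, (leavesP w' P).smallCouplings → Nodes (leavesP w' P)` — the world is `{w with βup := c, γ := γ'}`; the guarded nodes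
at `w` serve it because its window is smaller (`smallCouplings_of_reletter_le`), the other twelve mains transfer (`nodes_leavesP_reletter_ceiling`).  ONE node, asked in-window only.  CONDITIONAL.
[cite: Balaban1988Convergent, Thm 1 p.262, (2.6) p.255; Balaban1989LargeFieldI, (1.2) p.178; Balaban1989LargeFieldII, Thm 1 p.355 (bookkeeping)] -/
theorem ceilingKeyedRung1VW_of_nodesW_of_b14RaiseW (θ : Node00.Stage13HParams F 2) (h : θ.Provisos₁₃SepCoPH F 2) (v : Node00.Revision₁₃ F 2 θ h) (w : WorldP)
    (hR : RecordSV F θ h v w) (hnodesW : ∀ P : B12.RunParams, (leavesP w P).smallCouplings → Nodes (leavesP w P))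
    (hraiseW : ∀ c : ℝ, ∃ γ' : ℝ, 0 < γ' ∧ γ' ≤ w.γ ∧ ∀ P : B12.RunParams,
      (leavesP { w with βup := c, γ := γ' } P).smallCouplings → Dag.B14_main (leavesP { w with βup := c, γ := γ' } P)) :
    ∀ c : ℝ, ∃ w' : WorldP, c ≤ w'.βup ∧ RecordSV F θ h v w' ∧ ∀ P : B12.RunParams, (leavesP w' P).smallCouplings → Nodes (leavesP w' P) := fun c => by
  obtain ⟨γ', hγ'0, hγ', h14⟩ := hraiseW c
  exact ⟨{ w with βup := c, γ := γ' }, le_rfl, recordSV_reletter_ceiling hR c hγ'0 hγ',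
    fun P hsc => nodes_leavesP_reletter_ceiling w hγ' P (hnodesW P (smallCouplings_of_reletter_le w hγ' P hsc)) (h14 P hsc)⟩

end Reletter

/-! ## §2 The corner road at a rung-1ⱽᵂ witness (VW rungs BY NAME over DEF-1's `K1V10Defs`) -/

section Corner

/-- **RUNG 2ⱽᵂ‴ FROM RUNG-1ⱽᵂ DATA + THE CORNER LETTERS, ANY SLACK**: `(θ, h, v, w)` with `RecordSV`, the GUARDED nodes, U3ᴷ-lite moduli-with-mass, anchor, positive drift, `s + 2A < w.βup` ⟹
`RunRowsContAtSomeRecord13PWSVW F` at the same witness (p630391's `runLettersAtCeiling_at` at `c := w.βup`; the guarded nodes pass through).  CONDITIONAL; closes nothing.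
[cite: Balaban1989LargeFieldI, (1.2) p.178; Balaban1987RG1, Thm 3 p.264, (2.12)-(2.14) p.268, (5.10) p.293, §1 pp.263-264 (statement shapes)] -/
theorem runRowsContAtSomeRecord13PWSVW_of_rung1VWAt_cornerLetters_lt (θ : Node00.Stage13HParams F 2) (h : θ.Provisos₁₃SepCoPH F 2) (v : Node00.Revision₁₃ F 2 θ h) (w : WorldP)
    (hU : θ.ZhUnity F 2 ∧ θ.SlotsNondegenerate₁₃ F 2) (hθ : θ.Admissible F 2) (hRV : RecordSV F θ h v w)
    (hnodesW : ∀ P : B12.RunParams, (leavesP w P).smallCouplings → Nodes (leavesP w P))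
    {Λ : ℕ → ℕ → ℝ} {M : ℝ} (hL : HistLipschitz Λ θ.γ (Node00.betaOfRecord₁₃ F 2 θ.toStage13Params)) (hM : ∀ k, ∑ i : Fin (k + 1), |Λ k i| ≤ M)
    {b : ℕ → ℝ} {s A : ℝ} (hb : ScaleAnchor (Node00.betaOfRecord₁₃ F 2 θ.toStage13Params) b) (hs : 0 < s) (hdrift : OneLoopDrift s A b) (hmatch : s + 2 * A < w.βup) :
    RunRowsContAtSomeRecord13PWSVW F :=
  ⟨θ, h, v, w, hU, hθ, hRV, hnodesW, runLettersAtCeiling_at θ hθ hL hM hb hs hdrift hmatch⟩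

/-- **RUNG 2ⱽᵂ‴ MATCH-FREE (guarded ceiling-keyed rung 1ⱽᵂ)**: `∀ c, ∃ w, c ≤ w.βup ∧ RecordSV F θ h v w ∧ ∀ P, smallCouplings → Nodes` + the corner letters ⟹ `RunRowsContAtSomeRecord13PWSVW F`.
CONDITIONAL; closes nothing. [cite: Balaban1988Convergent, Thm 1 p.262; Balaban1987RG1, Thm 3 p.264, (2.12)-(2.14) p.268, (5.10) p.293 (statement shapes)] -/
theorem runRowsContAtSomeRecord13PWSVW_of_ceilingKeyedRung1VW_cornerLetters (θ : Node00.Stage13HParams F 2) (h : θ.Provisos₁₃SepCoPH F 2) (v : Node00.Revision₁₃ F 2 θ h)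
    (hU : θ.ZhUnity F 2 ∧ θ.SlotsNondegenerate₁₃ F 2) (hθ : θ.Admissible F 2)
    (hfamW : ∀ c : ℝ, ∃ w : WorldP, c ≤ w.βup ∧ RecordSV F θ h v w ∧ ∀ P : B12.RunParams, (leavesP w P).smallCouplings → Nodes (leavesP w P))
    {Λ : ℕ → ℕ → ℝ} {M : ℝ} (hL : HistLipschitz Λ θ.γ (Node00.betaOfRecord₁₃ F 2 θ.toStage13Params)) (hM : ∀ k, ∑ i : Fin (k + 1), |Λ k i| ≤ M)
    {b : ℕ → ℝ} {s A : ℝ} (hb : ScaleAnchor (Node00.betaOfRecord₁₃ F 2 θ.toStage13Params) b) (hs : 0 < s) (hdrift : OneLoopDrift s A b) :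
    RunRowsContAtSomeRecord13PWSVW F := by
  obtain ⟨w, hc, hRV, hnodesW⟩ := hfamW (s + 2 * A + 1)
  exact runRowsContAtSomeRecord13PWSVW_of_rung1VWAt_cornerLetters_lt θ h v w hU hθ hRV hnodesW hL hM hb hs hdrift (by linarith)

/-- **★ THE REGISTERED JOINT STUB TEXT 2ⱽᵂ∘3ⱽᵂ «∀ F, NodesAtSomeRecord13PWSVW F → RunRowsContAtSomeRecord13PWSVW F» ON THE CORNER ROAD**, from three K1-side letters: `hN11VW` = N11 ceiling-uniform
IN-WINDOW at rung-1ⱽᵂ core data (at every `(θ, h, v, w)` with unity∧slots, admissibility, `RecordSV`, GUARDED nodes: for every ceiling `c`, SOME `γ' ∈ ]0, w.γ]` with `Dag.B14_main` IN-WINDOW at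
`{w with βup := c, γ := γ'}` — ONE node; incomparable with p630391's `hN11V`), `hLite` = U3ᴷ-lite moduli-with-mass, `hCD` = anchor + POSITIVE drift (both keyed on provisos ∕ unity∧slots ∕ admissibility
ALONE).  The stub-1ⱽᵂ pins are read and dropped.  CONDITIONAL on three displayed texts (none supplied here); closes NO stub by itself; nothing of Bałaban asserted.
[cite: Balaban1988Convergent, Thm 1 p.262, (2.6) p.255; Balaban1989LargeFieldI, (1.2) p.178; Balaban1987RG1, Thm 3 p.264, (2.12)-(2.14) p.268, (5.10) p.293, §1 pp.263-264 and §5 p.298 (statement shapes)] -/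
theorem stub_runRowsCont13VWText_of_n11CUVW_liteText_cornerText
    (hN11VW : ∀ (F : T4Family) (θ : Node00.Stage13HParams F 2) (h : θ.Provisos₁₃SepCoPH F 2) (v : Node00.Revision₁₃ F 2 θ h) (w : WorldP),
      (θ.ZhUnity F 2 ∧ θ.SlotsNondegenerate₁₃ F 2) → θ.Admissible F 2 → RecordSV F θ h v w → (∀ P : B12.RunParams, (leavesP w P).smallCouplings → Nodes (leavesP w P)) →
      ∀ c : ℝ, ∃ γ' : ℝ, 0 < γ' ∧ γ' ≤ w.γ ∧ ∀ P : B12.RunParams,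
        (leavesP { w with βup := c, γ := γ' } P).smallCouplings → Dag.B14_main (leavesP { w with βup := c, γ := γ' } P))
    (hLite : ∀ (F : T4Family) (θ : Node00.Stage13HParams F 2), θ.Provisos₁₃SepCoPH F 2 → (θ.ZhUnity F 2 ∧ θ.SlotsNondegenerate₁₃ F 2) → θ.Admissible F 2 →
      ∃ (Λ : ℕ → ℕ → ℝ) (M : ℝ), HistLipschitz Λ θ.γ (Node00.betaOfRecord₁₃ F 2 θ.toStage13Params) ∧ ∀ k, ∑ i : Fin (k + 1), |Λ k i| ≤ M)
    (hCD : ∀ (F : T4Family) (θ : Node00.Stage13HParams F 2), θ.Provisos₁₃SepCoPH F 2 → (θ.ZhUnity F 2 ∧ θ.SlotsNondegenerate₁₃ F 2) → θ.Admissible F 2 →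
      ∃ (b : ℕ → ℝ) (s A : ℝ), ScaleAnchor (Node00.betaOfRecord₁₃ F 2 θ.toStage13Params) b ∧ 0 < s ∧ OneLoopDrift s A b) :
    ∀ F : T4Family, NodesAtSomeRecord13PWSVW F → RunRowsContAtSomeRecord13PWSVW F := by
  intro F hN
  obtain ⟨θ, h, v, w, hU, hθ, hRV, hnodesW, -, -⟩ := hN
  obtain ⟨Λ, M, hL, hM⟩ := hLite F θ h hU hθ
  obtain ⟨b, s, A, hb, hs, hdrift⟩ := hCD F θ h hU hθ
  exact runRowsContAtSomeRecord13PWSVW_of_ceilingKeyedRung1VW_cornerLetters θ h v hU hθ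
    (ceilingKeyedRung1VW_of_nodesW_of_b14RaiseW θ h v w hRV hnodesW (hN11VW F θ h v w hU hθ hRV hnodesW)) hL hM hb hs hdrift

end Corner

/-! ## §3 The row-mass road at a rung-1ⱽᵂ witness -/

section RowMass

/-- **RUNG 2ⱽᵂ‴ FROM RUNG-1ⱽᵂ DATA + THE ROW-MASS LETTERS, WITH ROOM UNDER THE CEILING** (`s′ + 2Lγ + 2L∕√s ≤ w.βup`; the keyed sibling's `runLettersAtCeiling_of_rowMass_runs`; guarded nodes pass
through).  CONDITIONAL; closes nothing. [cite: Balaban1989LargeFieldI, (1.2) p.178; Balaban1987RG1, Thm 2 (0.31) p.259, Thm 3 p.264, (5.10) p.293, §1 pp.263-264 (statement shapes)] -/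
theorem runRowsContAtSomeRecord13PWSVW_of_rung1VWAt_rowMassRuns_le (θ : Node00.Stage13HParams F 2) (h : θ.Provisos₁₃SepCoPH F 2) (v : Node00.Revision₁₃ F 2 θ h) (w : WorldP)
    (hU : θ.ZhUnity F 2 ∧ θ.SlotsNondegenerate₁₃ F 2) (hθ : θ.Admissible F 2) (hRV : RecordSV F θ h v w)
    (hnodesW : ∀ P : B12.RunParams, (leavesP w P).smallCouplings → Nodes (leavesP w P))
    {γ L s s' : ℝ} {Λ : ℕ → ℕ → ℝ} (hL : HistLipschitz Λ γ (Node00.betaOfRecord₁₃ F 2 θ.toStage13Params)) (hM : ∀ k, ∑ i : Fin (k + 1), |Λ k i| ≤ L) (hγ : 0 < γ) (hs : 0 < s)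
    (hruns : ∀ K : ℕ, ∃ r : ℕ → ℝ, RGEqH K (Node00.betaOfRecord₁₃ F 2 θ.toStage13Params) r ∧ Step.InInterval γ K r ∧ Step.Discrete031 s s' K (r K) r)
    (hc : s' + 2 * L * γ + 2 * L / Real.sqrt s ≤ w.βup) : RunRowsContAtSomeRecord13PWSVW F :=
  ⟨θ, h, v, w, hU, hθ, hRV, hnodesW, runLettersAtCeiling_of_rowMass_runs hL hM hγ hs hruns hc⟩

/-- **RUNG 2ⱽᵂ‴ MATCH-FREE (guarded ceiling-keyed rung 1ⱽᵂ) on the row-mass road.**  CONDITIONAL; closes nothing.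
[cite: Balaban1988Convergent, Thm 1 p.262; Balaban1987RG1, Thm 2 (0.31) p.259, Thm 3 p.264, (5.10) p.293 (statement shapes)] -/
theorem runRowsContAtSomeRecord13PWSVW_of_ceilingKeyedRung1VW_rowMassRuns (θ : Node00.Stage13HParams F 2) (h : θ.Provisos₁₃SepCoPH F 2) (v : Node00.Revision₁₃ F 2 θ h)
    (hU : θ.ZhUnity F 2 ∧ θ.SlotsNondegenerate₁₃ F 2) (hθ : θ.Admissible F 2)
    (hfamW : ∀ c : ℝ, ∃ w : WorldP, c ≤ w.βup ∧ RecordSV F θ h v w ∧ ∀ P : B12.RunParams, (leavesP w P).smallCouplings → Nodes (leavesP w P))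
    {γ L s s' : ℝ} {Λ : ℕ → ℕ → ℝ} (hL : HistLipschitz Λ γ (Node00.betaOfRecord₁₃ F 2 θ.toStage13Params)) (hM : ∀ k, ∑ i : Fin (k + 1), |Λ k i| ≤ L) (hγ : 0 < γ) (hs : 0 < s)
    (hruns : ∀ K : ℕ, ∃ r : ℕ → ℝ, RGEqH K (Node00.betaOfRecord₁₃ F 2 θ.toStage13Params) r ∧ Step.InInterval γ K r ∧ Step.Discrete031 s s' K (r K) r) :
    RunRowsContAtSomeRecord13PWSVW F := by
  obtain ⟨w, hcw, hRV, hnodesW⟩ := hfamW (s' + 2 * L * γ + 2 * L / Real.sqrt s)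
  exact runRowsContAtSomeRecord13PWSVW_of_rung1VWAt_rowMassRuns_le θ h v w hU hθ hRV hnodesW hL hM hγ hs hruns hcw

/-- **★ THE REGISTERED JOINT STUB TEXT 2ⱽᵂ∘3ⱽᵂ ON THE ROW-MASS ROAD**, from TWO letters: `hN11VW` (N11 in-window at every raised ceiling, as in §2) and the ∀θ ROW-MASS-RUNS letter (idea-7's
`RowMassRunsAll`, INLINE: U3ᴷ-lite moduli WITH ROW MASS on some box + ONE lower-(0.31) run of `β_θ` per depth, at every admissible tuple with provisos — which CARRIES the pointwise AF-sign datum,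
keyed sibling §1b).  ANCHOR-FREE, DRIFT-FREE, FADING-FREE.  CONDITIONAL on both displayed texts (none supplied here); closes NO stub by itself; nothing of Bałaban asserted.
[cite: Balaban1988Convergent, Thm 1 p.262, (2.6) p.255; Balaban1989LargeFieldI, (1.2) p.178; Balaban1987RG1, Thm 2 (0.31) p.259, Thm 3 p.264, (2.12)-(2.14) p.268, (5.10) p.293, §5 p.298 (statement shapes)] -/
theorem stub_runRowsCont13VWText_of_n11CUVW_rowMassRunsText
    (hN11VW : ∀ (F : T4Family) (θ : Node00.Stage13HParams F 2) (h : θ.Provisos₁₃SepCoPH F 2) (v : Node00.Revision₁₃ F 2 θ h) (w : WorldP),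
      (θ.ZhUnity F 2 ∧ θ.SlotsNondegenerate₁₃ F 2) → θ.Admissible F 2 → RecordSV F θ h v w → (∀ P : B12.RunParams, (leavesP w P).smallCouplings → Nodes (leavesP w P)) →
      ∀ c : ℝ, ∃ γ' : ℝ, 0 < γ' ∧ γ' ≤ w.γ ∧ ∀ P : B12.RunParams,
        (leavesP { w with βup := c, γ := γ' } P).smallCouplings → Dag.B14_main (leavesP { w with βup := c, γ := γ' } P))
    (hRM : ∀ (F : T4Family) (θ : Node00.Stage13HParams F 2), θ.Provisos₁₃SepCoPH F 2 → θ.Admissible F 2 →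
      ∃ (γ L s s' : ℝ) (Λ : ℕ → ℕ → ℝ), HistLipschitz Λ γ (Node00.betaOfRecord₁₃ F 2 θ.toStage13Params) ∧ (∀ k, ∑ i : Fin (k + 1), |Λ k i| ≤ L) ∧ 0 < γ ∧ 0 < s ∧
        ∀ K : ℕ, ∃ r : ℕ → ℝ, RGEqH K (Node00.betaOfRecord₁₃ F 2 θ.toStage13Params) r ∧ Step.InInterval γ K r ∧ Step.Discrete031 s s' K (r K) r) :
    ∀ F : T4Family, NodesAtSomeRecord13PWSVW F → RunRowsContAtSomeRecord13PWSVW F := by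
  intro F hN
  obtain ⟨θ, h, v, w, hU, hθ, hRV, hnodesW, -, -⟩ := hN
  obtain ⟨γ, L, s, s', Λ, hL, hM, hγ, hs, hruns⟩ := hRM F θ h hθ
  exact runRowsContAtSomeRecord13PWSVW_of_ceilingKeyedRung1VW_rowMassRuns θ h v hU hθ
    (ceilingKeyedRung1VW_of_nodesW_of_b14RaiseW θ h v w hRV hnodesW (hN11VW F θ h v w hU hθ hRV hnodesW)) hL hM hγ hs hruns

end RowMass

/-! ## §4 The registered `stub_runRows13PWSVW` ∕ `stub_cont13VW` signatures literally -/

section Stubs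

/-- **THE REGISTERED `stub_runRows13PWSVW` SIGNATURE `∀ F, NodesAtSomeRecord13PWSVW F → RunRowsAtSomeRecord13PWSVW F` ON THE CORNER ROAD** (§2 ★, (C) dropped).  CONDITIONAL on the three
letters (none supplied here); the registered stub is NOT closed by this theorem. [cite: Balaban1987RG1, Thm 3 p.264, (2.12)-(2.14) p.268, (5.10) p.293 (statement shapes)] -/
theorem stub_runRows13PWSVWText_of_n11CUVW_liteText_cornerText
    (hN11VW : ∀ (F : T4Family) (θ : Node00.Stage13HParams F 2) (h : θ.Provisos₁₃SepCoPH F 2) (v : Node00.Revision₁₃ F 2 θ h) (w : WorldP),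
      (θ.ZhUnity F 2 ∧ θ.SlotsNondegenerate₁₃ F 2) → θ.Admissible F 2 → RecordSV F θ h v w → (∀ P : B12.RunParams, (leavesP w P).smallCouplings → Nodes (leavesP w P)) →
      ∀ c : ℝ, ∃ γ' : ℝ, 0 < γ' ∧ γ' ≤ w.γ ∧ ∀ P : B12.RunParams,
        (leavesP { w with βup := c, γ := γ' } P).smallCouplings → Dag.B14_main (leavesP { w with βup := c, γ := γ' } P))
    (hLite : ∀ (F : T4Family) (θ : Node00.Stage13HParams F 2), θ.Provisos₁₃SepCoPH F 2 → (θ.ZhUnity F 2 ∧ θ.SlotsNondegenerate₁₃ F 2) → θ.Admissible F 2 →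
      ∃ (Λ : ℕ → ℕ → ℝ) (M : ℝ), HistLipschitz Λ θ.γ (Node00.betaOfRecord₁₃ F 2 θ.toStage13Params) ∧ ∀ k, ∑ i : Fin (k + 1), |Λ k i| ≤ M)
    (hCD : ∀ (F : T4Family) (θ : Node00.Stage13HParams F 2), θ.Provisos₁₃SepCoPH F 2 → (θ.ZhUnity F 2 ∧ θ.SlotsNondegenerate₁₃ F 2) → θ.Admissible F 2 →
      ∃ (b : ℕ → ℝ) (s A : ℝ), ScaleAnchor (Node00.betaOfRecord₁₃ F 2 θ.toStage13Params) b ∧ 0 < s ∧ OneLoopDrift s A b) :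
    ∀ F : T4Family, NodesAtSomeRecord13PWSVW F → RunRowsAtSomeRecord13PWSVW F :=
  fun F hN => runRowsAtSomeRecord13PWSVW_of_runRowsContAtSomeRecord13PWSVW F (stub_runRowsCont13VWText_of_n11CUVW_liteText_cornerText hN11VW hLite hCD F hN)

/-- **THE REGISTERED `stub_runRows13PWSVW` SIGNATURE ON THE ROW-MASS ROAD** (§3 ★, (C) dropped).  CONDITIONAL on the two letters; the registered stub is NOT closed by this theorem.
[cite: Balaban1987RG1, Thm 2 (0.31) p.259, Thm 3 p.264, (5.10) p.293 (statement shapes)] -/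
theorem stub_runRows13PWSVWText_of_n11CUVW_rowMassRunsText
    (hN11VW : ∀ (F : T4Family) (θ : Node00.Stage13HParams F 2) (h : θ.Provisos₁₃SepCoPH F 2) (v : Node00.Revision₁₃ F 2 θ h) (w : WorldP),
      (θ.ZhUnity F 2 ∧ θ.SlotsNondegenerate₁₃ F 2) → θ.Admissible F 2 → RecordSV F θ h v w → (∀ P : B12.RunParams, (leavesP w P).smallCouplings → Nodes (leavesP w P)) →
      ∀ c : ℝ, ∃ γ' : ℝ, 0 < γ' ∧ γ' ≤ w.γ ∧ ∀ P : B12.RunParams,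
        (leavesP { w with βup := c, γ := γ' } P).smallCouplings → Dag.B14_main (leavesP { w with βup := c, γ := γ' } P))
    (hRM : ∀ (F : T4Family) (θ : Node00.Stage13HParams F 2), θ.Provisos₁₃SepCoPH F 2 → θ.Admissible F 2 →
      ∃ (γ L s s' : ℝ) (Λ : ℕ → ℕ → ℝ), HistLipschitz Λ γ (Node00.betaOfRecord₁₃ F 2 θ.toStage13Params) ∧ (∀ k, ∑ i : Fin (k + 1), |Λ k i| ≤ L) ∧ 0 < γ ∧ 0 < s ∧
        ∀ K : ℕ, ∃ r : ℕ → ℝ, RGEqH K (Node00.betaOfRecord₁₃ F 2 θ.toStage13Params) r ∧ Step.InInterval γ K r ∧ Step.Discrete031 s s' K (r K) r) :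
    ∀ F : T4Family, NodesAtSomeRecord13PWSVW F → RunRowsAtSomeRecord13PWSVW F :=
  fun F hN => runRowsAtSomeRecord13PWSVW_of_runRowsContAtSomeRecord13PWSVW F (stub_runRowsCont13VWText_of_n11CUVW_rowMassRunsText hN11VW hRM F hN)

/-- **★ THE REGISTERED `stub_cont13VW` SIGNATURE `∀ F, RunRowsAtSomeRecord13PWSVW F → RunRowsContAtSomeRecord13PWSVW F` FROM MODULI ON SOME BOX** (the VW twin of the keyed sibling's
`stub_cont13VText_of_boxModuli`; both roads' U3ᴷ-lite letters qualify): keep the witness and its rows, cut the level to `min γ₀ γ`, read (C) there from the moduli (`betaContH_of_histLipschitz`,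
`box_mono`, `SurvCont.of_betaContH`).  CONDITIONAL on the letter; the registered stub is NOT closed by this theorem. [cite: Balaban1987RG1, §1 pp.263-264, (2.13) p.268 and Thm 3 p.264] -/
theorem stub_cont13VWText_of_boxModuli
    (hMod : ∀ (F : T4Family) (θ : Node00.Stage13HParams F 2), θ.Provisos₁₃SepCoPH F 2 → (θ.ZhUnity F 2 ∧ θ.SlotsNondegenerate₁₃ F 2) → θ.Admissible F 2 →
      ∃ (γ : ℝ) (Λ : ℕ → ℕ → ℝ), 0 < γ ∧ HistLipschitz Λ γ (Node00.betaOfRecord₁₃ F 2 θ.toStage13Params)) :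
    ∀ F : T4Family, RunRowsAtSomeRecord13PWSVW F → RunRowsContAtSomeRecord13PWSVW F := by
  intro F hrows
  obtain ⟨θ, h, v, w, hU, hθ, hRV, hnodesW, b, r, γ₀, B, M, hγ₀, hrem, hB, hmatch, hps⟩ := hrows
  obtain ⟨γ, Λ, hγ, hL⟩ := hMod F θ h hU hθ
  have hγ₁ : 0 < min γ₀ γ := lt_min hγ₀ hγ
  refine ⟨θ, h, v, w, hU, hθ, hRV, hnodesW, b, r, min γ₀ γ, B, M, hγ₁, hrem.mono (min_le_left _ _), hB, hmatch, ?_,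
    SurvCont.of_betaContH hγ₁ fun k => (T4BetaStationary.betaContH_of_histLipschitz hL k).mono (FlowStep.box_mono (min_le_right _ _) k)⟩
  intro n gs hrg hI k hk
  exact hps n gs hrg (fun j hj => ⟨(hI j hj).1, (hI j hj).2.trans (min_le_left _ _)⟩) k hk

end Stubs

end Summit.QuantumFields.YangMills.Theorems.BalabanUVNodesK2CornerRoadLine2W

end
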